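import Literature.NumberTheory.LFunctions.ZetaSpacingDensityRH
import HarnessLib

/-!
# Route `PrimeLevelFamEdge` — TYPED IDEA DELTAS, deck 18: FLOOR INPUTS for the Montgomery form factor beyond
# `|α| = 1`, typed against the tree's BGMM 2023 engine (cell ls-idea, seat ls-idea-lens-21 `barrier` × CI-GAPS,
# card K-L21-1 «THE WALL HAS TWO FACES»; critic F b4 PASS as wall map (FIX P-F4-1 = card wording only);
# LANDING NOTE typer ls-idea-typ-1 gen 2: the seat's `Sketch_L21_FloorInput.lean` sha16 53dde5f25f0ccd81 VERBATIM
# up to (i) namespace `LsIdea.Lens21` → the deck namespace `.FloorInput`, (ii) F's P-F4-2 guard: the floor credit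
# in `cValueFloor` is the SET integral over `Set.Icc 1 B` (orientation-free; empty, hence no junk credit, for
# `B < 1`) instead of the oriented `∫ α in 1..B`, (iii) the 0-ary computed claim `HeightWallClaim` made PARAMETRIC
# in the threshold height `c₀` (card: `c₀ = 0.78`), (iv) one docstring added.)  TYPED ≠ PROVED; COMPUTED ≠ PROVED.

Nothing here is a theorem about zeta: the `def … : Prop` marked CRUX / CLAIM are hypotheses/claims, the
`theorem`s are compositions of tree theorems (no `sorry`).

* `FormFactorFloor L B` — the INPUT class of the card: on RH, `F(α,T) ≥ L(α) − ε` eventually in `T`,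
  uniformly for `1 ≤ |α| ≤ B` (a one-sided = floor statement; `L ≡ c` is RAY H of the card,
  `L = c·1_{(a,2]}` is RAY G).  In prime currency (Goldston–Montgomery 1987, Thm 2 dictionary
  `α ↔ h = X^{1−1/α}`) a floor on `(1, B]` is a one-sided Hardy–Littlewood-on-average statement for
  `ψ(x+h) − ψ(x)` in the range `1 ≤ h ≤ X^{1−1/B}`.
* `IsFloorAdmissible r lam` — BGMM's class `𝒜(λ)` (`BGMM2023.IsAdmissible`) with (iii) `r̂ ≥ 0`
  required only for `|α| ≥ 1` (on `[−1,1]` Montgomery's theorem gives `F`, so no sign is needed there;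
  this is the LP class of K-L10-1 v6/v8 and of this card's solver).
* `cValueFloor r L B = c(λ;r) + 2∫_{[1,B]} L(α) r̂(α) dα` — the criterion value WITH floor credit (set integral:
  no credit when `B < 1`, critic F P-F4-2).
* CRUX `FloorCriterion L B` — the floor analogue of `BGMM2023.buiEtAl2023_theorem3` (2): typed, NOT
  proved (its proof would be BGMM §3 verbatim with `∫_{1≤|α|≤B} F r̂ ≥ ∫ L r̂ − ε‖r̂‖₁` in place of `≥ 0`).
* CLAIM `FloorCertificate L B lam` — "the LP certifies `lam`": `∃ r ∈` class with `cValueFloor > 0`.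
  The card's numbers (λ = 0.499): RAY H `L ≡ c` on `(1,B]`: least certifying `c*(B)` = 0.992 (B=1.35),
  0.855 (1.5), 0.785 (1.75), 0.773 (2.0) = 0.773 (2.5) = 0.773 (3.0) — SATURATION at `B = 2`;
  RAY G `L = c` on `(a,2]`: c*(a) = 0.898 (a=1.05), 1.043 (1.1), 1.383 (1.2), 1.848 (1.3);
  node floors on `|α−2| ≤ w ≤ 0.75` never certify at height ≤ 2.  Cosine class K ∈ {14,20,26},
  free band-limit B_free ≤ 5, tail class `r ≤ 10⁻⁹` on `[λ,240]`; float interior-point LP + bisection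
  (tol 5·10⁻³); COMPUTED, NOT PROVED.
* `door_of_floorCriterion` — the composed chain to the CI door `∃ c > 0, SubnormalGapsHypothesis c`
  (odd real primitive characters only, via `conreyIwaniec2002_theorem12` downstream), with EVERY
  load-bearing hypothesis explicit: RH, the floor, the criterion, an LP certificate `r` at some
  `lam < 1/2`, BGMM's multiplicity rider `ν < cValueFloor + 1`, and one close pair below height 2001.

HONESTY: no exceptional-zero theorem (no Landau–Siegel / Siegel-zero exclusion, no Theorem 1–2 of
arXiv:2211.02515, no repaired Margin232) is proved by ideation; typed ≠ proved; computed ≠ proved.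
-/

namespace Summit.Parity.GeneralizedHardyLittlewood.Theorems.PrimeLevelFamEdgeIdeaDeltas.FloorInput

open Literature.NumberTheory.LFunctions Filter MeasureTheory
open scoped Real

/-- INPUT (floor): on RH, `F(α,T) ≥ L(α) − ε` for all large `T`, uniformly in `1 ≤ |α| ≤ B`. -/
def FormFactorFloor (L : ℝ → ℝ) (B : ℝ) : Prop :=
  RiemannHypothesis → ∀ ε : ℝ, 0 < ε → ∀ᶠ T : ℝ in atTop,
    ∀ α : ℝ, 1 ≤ |α| → |α| ≤ B → L α - ε ≤ montgomeryFormFactor α T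

/-- RAY H input: constant floor of HEIGHT `c` on `1 ≤ |α| ≤ B`. AH-false (a.c. part of the AH form
factor is the triangle wave `s(α)`, `< c` on `(2 − c, 2)`) iff `c > max (2 − B) 0`. -/
def HeightFloor (c B : ℝ) : Prop :=
  FormFactorFloor (fun _ => c) B

/-- RAY G input: floor of height `c` on `a ≤ |α| ≤ 2` only (the band `(1, a)` left uncovered). -/
def GapFloor (c a : ℝ) : Prop :=
  FormFactorFloor (fun α => if a ≤ |α| then c else 0) 2

/-- The one-sided class: BGMM's `𝒜(λ)` with `r̂ ≥ 0` demanded only for `|α| ≥ 1`. -/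
structure IsFloorAdmissible (r : ℝ → ℝ) (lam : ℝ) : Prop where
  even : ∀ u : ℝ, r (-u) = r u
  continuous : Continuous r
  integrable : MeasureTheory.Integrable r
  map_zero : r 0 = 1
  nonpos : ∀ u : ℝ, lam < |u| → r u ≤ 0
  transform_nonneg_tail : ∀ α : ℝ, 1 ≤ |α| → 0 ≤ BGMM2023.cosTransform r α

/-- BGMM's class is contained in the one-sided class. -/
theorem IsFloorAdmissible.of_isAdmissible {r : ℝ → ℝ} {lam : ℝ}
    (h : BGMM2023.IsAdmissible r lam) : IsFloorAdmissible r lam :=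
  ⟨h.even, h.continuous, h.integrable, h.map_zero, h.nonpos, fun α _ => h.transform_nonneg α⟩

/-- Criterion value with floor credit: `c(λ;r) + 2 ∫_{[1,B]} L(α) r̂(α) dα` (SET integral over `Set.Icc 1 B` —
critic F P-F4-2: the oriented `∫ α in 1..B` would credit a junk sign for `B < 1`; for `B < 1` the set is empty
and the value is `c(λ;r)`). -/
noncomputable def cValueFloor (r L : ℝ → ℝ) (B : ℝ) : ℝ :=
  BGMM2023.cValue r + 2 * ∫ α in Set.Icc (1 : ℝ) B, L α * BGMM2023.cosTransform r α

/-- CRUX (typed, NOT proved): the floor analogue of BGMM 2023 Theorem 3 (2). -/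
def FloorCriterion (L : ℝ → ℝ) (B : ℝ) : Prop :=
  RiemannHypothesis → FormFactorFloor L B →
    ∀ (lam : ℝ) (r : ℝ → ℝ), 0 < lam → IsFloorAdmissible r lam →
      (∃ ν : ℝ, ν < cValueFloor r L B + 1 ∧ ∃ T₀ : ℝ, ∀ T : ℝ, T₀ ≤ T →
          (BGMM2023.multPairCount T : ℝ) ≤ ν * zetaZeroCount T) →
        BGMM2023.GapDensityPos lam

/-- CLAIM shape of the card's LP numbers ("the class certifies `lam` from the floor `L` on `(1,B]`"):
some `r` of the one-sided class has positive floor-credited criterion value. COMPUTED instances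
(not proved): `FloorCertificate (fun _ => c) 2 0.499` for `c ≥ 0.78`; none found for `c ≤ 0.75`. -/
def FloorCertificate (L : ℝ → ℝ) (B lam : ℝ) : Prop :=
  ∃ r : ℝ → ℝ, IsFloorAdmissible r lam ∧ 0 < cValueFloor r L B

/-- The card's WALL statement in the HEIGHT currency (COMPUTED threshold, typed as a claim; PARAMETRIC in the
threshold height `c₀` — the card's computed value is `c₀ = 0.78`, none found for `c ≤ 0.75`): every constant
floor of height `c ≥ c₀` on `1 ≤ |α| ≤ 2` is certified at `λ = 0.499`. -/
def HeightWallClaim (c₀ : ℝ) : Prop :=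
  ∀ c : ℝ, c₀ ≤ c → FloorCertificate (fun _ => c) 2 0.499

/-- CHAIN (proved by composition of tree theorems): criterion + floor + RH + an LP certificate at
some `lam < 1/2` whose margin absorbs BGMM's multiplicity rider + one close pair below 2001 ⟹ the
CI door `∃ c > 0, SubnormalGapsHypothesis c`. -/
theorem door_of_floorCriterion {L : ℝ → ℝ} {B lam : ℝ} {r : ℝ → ℝ}
    (hcrit : FloorCriterion L B) (hfloor : FormFactorFloor L B) (hRH : RiemannHypothesis)
    (hlam0 : 0 < lam) (hlam : lam < 1 / 2) (hr : IsFloorAdmissible r lam)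
    (hν : ∃ ν : ℝ, ν < cValueFloor r L B + 1 ∧ ∃ T₀ : ℝ, ∀ T : ℝ, T₀ ≤ T →
        (BGMM2023.multPairCount T : ℝ) ≤ ν * zetaZeroCount T)
    (h₀ : (closeCriticalZeros 2001).Nonempty) :
    ∃ c : ℝ, 0 < c ∧ SubnormalGapsHypothesis c :=
  BGMM2023.subnormalGapsHypothesis_of_gapDensityPos hRH hlam0.le hlam
    (hcrit hRH hfloor lam r hlam0 hr hν) h₀

/-- Same chain one step further, through Conrey–Iwaniec 2002 Theorem 1.2 (tree NAMED FACT
`conreyIwaniec2002_theorem12`, used as a hypothesis): the ODD half of the summit's `L(1,χ)` bound. -/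
theorem lOne_of_floorCriterion (hCI : conreyIwaniec2002_theorem12) {L : ℝ → ℝ} {B lam : ℝ}
    {r : ℝ → ℝ} (hcrit : FloorCriterion L B) (hfloor : FormFactorFloor L B)
    (hRH : RiemannHypothesis) (hlam0 : 0 < lam) (hlam : lam < 1 / 2) (hr : IsFloorAdmissible r lam)
    (hν : ∃ ν : ℝ, ν < cValueFloor r L B + 1 ∧ ∃ T₀ : ℝ, ∀ T : ℝ, T₀ ≤ T →
        (BGMM2023.multPairCount T : ℝ) ≤ ν * zetaZeroCount T)
    (h₀ : (closeCriticalZeros 2001).Nonempty) :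
    ∃ c' : ℝ, 0 < c' ∧
      ∀ (q : ℕ) [NeZero q], 4 < q → ∀ χ : DirichletCharacter ℂ q,
        χ.IsPrimitive → χ.IsQuadratic → χ.Odd →
          c' * Real.log q ^ (-(90 : ℝ)) ≤ ‖χ.LFunction 1‖ :=
  BGMM2023.lOne_lower_bound_of_gapDensityPos hCI hRH hlam0.le hlam (hcrit hRH hfloor lam r hlam0 hr hν) h₀

/-- Monotonicity bookkeeping (proved): a higher floor is a stronger input. -/
theorem FormFactorFloor.mono {L L' : ℝ → ℝ} {B : ℝ} (hLL' : ∀ α, L α ≤ L' α)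
    (h : FormFactorFloor L' B) : FormFactorFloor L B := by
  intro hRH ε hε
  filter_upwards [h hRH ε hε] with T hT α h1 hB
  exact le_trans (by linarith [hLL' α]) (hT α h1 hB)

/-- Monotonicity in the height (proved): a higher constant floor is a stronger input. -/
theorem HeightFloor.mono {c c' B : ℝ} (hcc' : c ≤ c') (h : HeightFloor c' B) : HeightFloor c B :=
  FormFactorFloor.mono (fun _ => hcc') h

/-! ### §v1.1 (appended by typer ls-idea-typ-1 gen 2 from the seat's Sketch v1.1 sha16 757699a372ff5f97, critic F b6
PASS final; VERBATIM up to: set integrals over `Set.Icc 1 B` as in `cValueFloor` above (orientation-free, F P-F4-2),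
`HeightWallClaimTol` PARAMETRIC in `(c₀, δ, X)`; the seat's v1.1 `1 ≤ B` guards on the NEW cruxes are kept; the
landed `FloorCriterion` / `FloorCertificate` of v1.0 are NOT mutated — with the set integral they need no guard.)

### P-F4-3: the AVERAGED floor (what the criterion actually consumes) -/

/-- INPUT (averaged floor): on RH, for every continuous weight `w ≥ 0`,
`∫_{[1,B]} L w − ε ≤ ∫_{[1,B]} F(·,T) w` eventually in `T` (set integrals). Weaker than `FormFactorFloor L B` (pointwise); it is the
form a Goldston–Montgomery 1987-type Tauberian transfer from primes in short intervals can deliver. -/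
def FormFactorFloorAvg (L : ℝ → ℝ) (B : ℝ) : Prop :=
  RiemannHypothesis → ∀ w : ℝ → ℝ, Continuous w → (∀ α : ℝ, 0 ≤ w α) → ∀ ε : ℝ, 0 < ε →
    ∀ᶠ T : ℝ in atTop,
      (∫ α in Set.Icc (1 : ℝ) B, L α * w α) - ε ≤ ∫ α in Set.Icc (1 : ℝ) B, montgomeryFormFactor α T * w α

/-- CRUX (typed, NOT proved): the criterion from the averaged floor. -/
def FloorCriterionAvg (L : ℝ → ℝ) (B : ℝ) : Prop :=
  RiemannHypothesis → 1 ≤ B → FormFactorFloorAvg L B →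
    ∀ (lam : ℝ) (r : ℝ → ℝ), 0 < lam → IsFloorAdmissible r lam →
      (∃ ν : ℝ, ν < cValueFloor r L B + 1 ∧ ∃ T₀ : ℝ, ∀ T : ℝ, T₀ ≤ T →
          (BGMM2023.multPairCount T : ℝ) ≤ ν * zetaZeroCount T) →
        BGMM2023.GapDensityPos lam

/-- CHAIN for the averaged floor (proved by composition). -/
theorem door_of_floorCriterionAvg {L : ℝ → ℝ} {B lam : ℝ} {r : ℝ → ℝ}
    (hcrit : FloorCriterionAvg L B) (hB : 1 ≤ B) (hfloor : FormFactorFloorAvg L B)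
    (hRH : RiemannHypothesis) (hlam0 : 0 < lam) (hlam : lam < 1 / 2) (hr : IsFloorAdmissible r lam)
    (hν : ∃ ν : ℝ, ν < cValueFloor r L B + 1 ∧ ∃ T₀ : ℝ, ∀ T : ℝ, T₀ ≤ T →
        (BGMM2023.multPairCount T : ℝ) ≤ ν * zetaZeroCount T)
    (h₀ : (closeCriticalZeros 2001).Nonempty) :
    ∃ c : ℝ, 0 < c ∧ SubnormalGapsHypothesis c :=
  BGMM2023.subnormalGapsHypothesis_of_gapDensityPos hRH hlam0.le hlam
    (hcrit hRH hB hfloor lam r hlam0 hr hν) h₀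

/-! ### P-F4-4: the δ-tolerant witness class (what was computed) and its charged criterion -/

/-- The δ-TOLERANT one-sided class with cut-off `X`: BGMM's (ii) `r ≤ 0` off the window is replaced by
`r ≤ δ` on `lam < |u| ≤ X` and the damped bound `r u ≤ δ (X/|u|)⁴` beyond `X` (the cosine class with
`r̂(±B) = r̂″(±B) = 0` decays like `|u|⁻⁴`; M-L21-1: it is NEVER exactly `≤ 0` on a half-line). The card's
optimisers are members with `δ = 10⁻⁹`, `X = 240` (grid-checked, COMPUTED not proved). -/
structure IsFloorAdmissibleTol (r : ℝ → ℝ) (lam δ X : ℝ) : Prop where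
  even : ∀ u : ℝ, r (-u) = r u
  continuous : Continuous r
  integrable : MeasureTheory.Integrable r
  map_zero : r 0 = 1
  le_tol : ∀ u : ℝ, lam < |u| → |u| ≤ X → r u ≤ δ
  decay : ∀ u : ℝ, X < |u| → r u ≤ δ * (X / |u|) ^ 4
  transform_nonneg_tail : ∀ α : ℝ, 1 ≤ |α| → 0 ≤ BGMM2023.cosTransform r α

/-- An exact member is a tolerant member for every `δ ≥ 0` and every cut-off `X ≥ lam`. -/
theorem IsFloorAdmissibleTol.of_isFloorAdmissible {r : ℝ → ℝ} {lam δ X : ℝ} (hδ : 0 ≤ δ)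
    (hX : lam ≤ X) (h : IsFloorAdmissible r lam) : IsFloorAdmissibleTol r lam δ X where
  even := h.even
  continuous := h.continuous
  integrable := h.integrable
  map_zero := h.map_zero
  le_tol u hu _ := (h.nonpos u hu).trans hδ
  decay u hu := (h.nonpos u (lt_of_le_of_lt hX hu)).trans (mul_nonneg hδ (by positivity))
  transform_nonneg_tail := h.transform_nonneg_tail

/-- The OFF-WINDOW CHARGE of a tolerant test function: the positive part of `r` summed over ordered pairs of
zero ordinates at normalised distance `> lam` (Montgomery-weighted), per zero, is eventually `≤ κ`.  For the
exact class it is `0`; for the card's cosine-class optimisers it is `O(δ · X · log T)`-small per unit — NOT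
estimated here (typed only). -/
def OffWindowCharge (r : ℝ → ℝ) (lam κ : ℝ) : Prop :=
  ∃ T₀ : ℝ, ∀ T : ℝ, T₀ ≤ T →
    (∑ p ∈ zeroIndexSet T ×ˢ zeroIndexSet T,
        if 2 * π * lam / Real.log T < |zetaOrdinate p.1 - zetaOrdinate p.2| then
          max (r ((zetaOrdinate p.1 - zetaOrdinate p.2) * Real.log T / (2 * π))) 0 *
            montgomeryWeight (zetaOrdinate p.1 - zetaOrdinate p.2)
        else 0) ≤ κ * zetaZeroCount T

/-- CRUX (typed, NOT proved): BGMM's criterion for the δ-tolerant class — the off-window charge `κ` joins the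
multiplicity rider `ν`: `ν + κ < cValueFloor r L B + 1` suffices. -/
def FloorCriterionTol (L : ℝ → ℝ) (B δ X : ℝ) : Prop :=
  RiemannHypothesis → 1 ≤ B → FormFactorFloor L B →
    ∀ (lam : ℝ) (r : ℝ → ℝ), 0 < lam → IsFloorAdmissibleTol r lam δ X →
      (∃ ν κ : ℝ, ν + κ < cValueFloor r L B + 1 ∧
          (∃ T₀ : ℝ, ∀ T : ℝ, T₀ ≤ T → (BGMM2023.multPairCount T : ℝ) ≤ ν * zetaZeroCount T) ∧
          OffWindowCharge r lam κ) →
        BGMM2023.GapDensityPos lam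

/-- CLAIM re-typed to what was COMPUTED (float LP in the cosine class `K ≤ 26`, `B_free ≤ 5`, class C_δ,
`δ = 10⁻⁹`, `X = 240`; NOT proved; PARAMETRIC in the threshold height `c₀` and the tolerance `(δ, X)` — the
card's instance is `HeightWallClaimTol 0.78 1e-9 240`): every floor height `c ≥ c₀` on `(1,2]` has a δ-tolerant
certificate at `λ = 0.499`. The exact-class `HeightWallClaim c₀` above is a different (plausible, un-witnessed)
statement. -/
def HeightWallClaimTol (c₀ δ X : ℝ) : Prop :=
  ∀ c : ℝ, c₀ ≤ c →
    ∃ r : ℝ → ℝ, IsFloorAdmissibleTol r 0.499 δ X ∧ 0 < cValueFloor r (fun _ => c) 2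

/-- CHAIN for the tolerant class (proved by composition). -/
theorem door_of_floorCriterionTol {L : ℝ → ℝ} {B δ X lam : ℝ} {r : ℝ → ℝ}
    (hcrit : FloorCriterionTol L B δ X) (hB : 1 ≤ B) (hfloor : FormFactorFloor L B)
    (hRH : RiemannHypothesis) (hlam0 : 0 < lam) (hlam : lam < 1 / 2)
    (hr : IsFloorAdmissibleTol r lam δ X)
    (hνκ : ∃ ν κ : ℝ, ν + κ < cValueFloor r L B + 1 ∧
        (∃ T₀ : ℝ, ∀ T : ℝ, T₀ ≤ T → (BGMM2023.multPairCount T : ℝ) ≤ ν * zetaZeroCount T) ∧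
        OffWindowCharge r lam κ)
    (h₀ : (closeCriticalZeros 2001).Nonempty) :
    ∃ c : ℝ, 0 < c ∧ SubnormalGapsHypothesis c :=
  BGMM2023.subnormalGapsHypothesis_of_gapDensityPos hRH hlam0.le hlam
    (hcrit hRH hB hfloor lam r hlam0 hr hνκ) h₀

end Summit.Parity.GeneralizedHardyLittlewood.Theorems.PrimeLevelFamEdgeIdeaDeltas.FloorInput
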